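import Summits.HodgeConjecture.HodgeConjecture.Theorems.R90S4TwistedTubeRadial              -- (B1-T) part 2b (this seat): `integrable_and_integral_epsTube_eq_of_sheetJacobian` (brings parts 1, 2a, ★ M1, M2, M2♭, ★ `cartanWeight`)
import Summits.HodgeConjecture.HodgeConjecture.Theorems.R90S4TwistedTubeOrbitalBase         -- ★ β CAN-ID: `IsEpsCanonicalAt.classEpsOrbitalIntegral_mk_eq_integral_descEpsConj_base`, `descEpsConj_base_mk`
import Summits.HodgeConjecture.HodgeConjecture.Theorems.R90S4EpsRegularTransport               -- ★ `isStablyEpsConjAt_of_isEpsConj`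
import HarnessLib

/-!
# R90-TF · S4 «Ch. 13.1–2», T-WIF road, (B1-T) part 3 — THE TWISTED WEYL INTEGRATION FORMULA OF ONE TUBE, RADIAL SIDE IN PRINT'S VARIABLE:
# `[Ñ^ε_T : T̃] · ∫_{Ψ(D)} φ β dνGt = ∫_{T^{reg}} D_T(t) • Φ^{st}_ε(sec₀ t, φ) β(sec₀ t) dt_T` (Rogawski 1990, §12.5 p. 186)

Cell `hodgecm-mathlib`, crux H413 (`stmt-HodgeConjecture-24833`, lane `--supports … --as helper`), route of record `HCCMUnconditional` (no route verbs;
count-neutral).  Programme R90-TF, section S4 = [Rogawski1990] Ch. 13.1–13.2; seat R90-C131-p03 (g3); plan of record S4-R30∕S4-R33, census `R90/R90-C131-p03/g3/CENSUS-B1-assembly.md` §4;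
(J̃♭) consumption bytes of record = R90 bus 2026-09-05 02:06:56Z (3).  THEOREMS ONLY — no `def`, no instance, no notation, no named-fact hypothesis, no `sorry`; ★-only imports.

HONEST LABEL: HC_CM is proved only modulo the 7 printed citations (2 remaining named inputs: hLiu418 = stmt-HodgeConjecture-24832, h413 =
stmt-HodgeConjecture-24833) until rung 0 closes.  CONDITIONAL on the letters (L2) (Borel norm section `s`), the `K_T`-representatives `R`, and (J̃♭) (hypothesis `hJac`) — discharges no
socket (REL ≠ ★ ≠ BUILT).

## The mathematics

SETTING as in parts 1∕2a∕2b; in addition the ε-orbital measure family `mGt` is CANONICAL for `νGt` (`hcan : IsEpsCanonicalAt`, ★ `R90S4EpsOrbitalCanonical`) and `τ′` is THE normalised Haar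
measure of `T′ = G̃_{δ₀ε}` (`τ′(compact core) = 1`), so that ★ β's CAN-ID reads every class integral `Φ_ε(⟦b⟧, φ)`, `b ∈ T̃^{ε-reg}`, on the common base `G̃_v ⧸ T′` against `μ₀ = νGt ∕ τ′`;
`β` is an ε-stable class function; `sec₀` is any norm section (`N(sec₀ γ) ∼ γ`).
* THE WEIGHT READ THROUGH THE NORM.  `N̄ : T̃ → T`, `N̄ b := N b` (`N b` is ε-fixed, ★ `epsLoc_epsNorm_of_mem_centralizer`, hence in `G_v`, ★ `epsLoc_eq_self_iff_mem_local`, and commutes with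
  `γ₀`), continuous; `Wt := cartanWeight T ∘ N̄` is Borel (★ `measurable_cartanWeight`) and reads `Wt(s t · u) = D_T(t)` on the sheets (`N(s t u) = t`).  So part 2b applies with NO weight letter.
* THE INNER INTEGRAL.  For `b ∈ B₀`: `β(Ψ(q, b)) = β(b)` (`Ψ(xT′, b) = x b ε(x)⁻¹` is ε-conjugate, hence stably ε-conjugate, to `b` — ★ `isStablyEpsConjAt_of_isEpsConj`), and
  `∫_{G̃_v ⧸ T′} φ(Ψ(q, b)) dμ₀(q) = Φ_ε(⟦b⟧, φ)` (★ CAN-ID `IsEpsCanonicalAt.classEpsOrbitalIntegral_mk_eq_integral_descEpsConj_base` + ★ `descEpsConj_base_mk`).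
* THE SHEETS.  `λ` is carried by `B₀`; part 1 `integral_sheetMeasure` gives `∫_{B₀} G dλ = Σ_{u ∈ R} ∫_{T^{reg}} G(s t · u) dt_T`, and pointwise on `T^{reg}`
  `Σ_u D_T(t) • Φ_ε(⟦s t u⟧, φ) β(s t u) = D_T(t) • Φ^{st}_ε(sec₀ t, φ) β(sec₀ t)` (part 1 `sum_sheet_classEpsOrbitalIntegral_mul_eq` = ★ M4-b over the norm transversal of the sheets).
* CONCLUSION (with part 2b's Bochner radial identity at `g = φ·β`): `[Ñ^ε_T : T̃] · ∫_{Ψ(D)} φ β dνGt = ∫_{T^{reg}} D_T(t) • (Φ^{st}_ε(sec₀ t, φ) β(sec₀ t)) dt_T`, and the integrand on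
  the right is `t_T`-integrable on `T^{reg}` (it is a.e. the finite sheet sum of integrable functions) — the T-side of the twisted Weyl integration formula for ONE Cartan, in print's variable.
The assembly over the stable classes of Cartans ((B1-Σ), `R90S4TwistedWeylMeasureOfTubeJacobians`) is the next file.

[cite: Rogawski1990, §12.5 p. 186; §4.10 (4.10.1) p. 57; §4.3 (4.3.1) p. 43] [cite: HarishChandra1970, Lemma 22; Lemma 42] [cite: Federer1969, §2.10.10]
-/

set_option autoImplicit false
-- the mandated namespace repeats the single-problem summit's segment (`HodgeConjecture.HodgeConjecture`)
set_option linter.dupNamespace false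

noncomputable section

open MeasureTheory Measure Set Filter Topology Function NumberField IsDedekindDomain
open scoped ENNReal NNReal MatrixGroups Pointwise

namespace Summit.HodgeConjecture.HodgeConjecture.R90.S4

open Literature.NumberTheory.Rogawski1990 Literature.NumberTheory.Rogawski1990.Ch4Sec10
open Literature.NumberTheory.Automorphic Literature.NumberTheory.Automorphic.UnitaryGroup
open Literature.MeasureTheory.Group
open Summit.HodgeConjecture.HodgeConjecture.Cruxes.H413.F0P3cStCharTSWeylCartanRadial

section Formula

variable {L : Type} [Field L] [NumberField L] [IsCMField L] {v : HeightOneSpectrum (𝓞 ↥(maximalRealSubfield L))}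
  (hns : ∀ w : PlacesOver L v, IsCMField.complexConj L • w.1 = w.1)
  {T : Subgroup ((UnitaryGroup.cmDatum L 3 (splitFormGL L : Matrix (Fin 3) (Fin 3) L)).Local v)}
  {γ₀ : (UnitaryGroup.cmDatum L 3 (splitFormGL L : Matrix (Fin 3) (Fin 3) L)).Local v} (hγ₀ : IsRegularElt (γ₀.val : GtLoc L v))
  (hT : T = Subgroup.centralizer ({γ₀} : Set ((UnitaryGroup.cmDatum L 3 (splitFormGL L : Matrix (Fin 3) (Fin 3) L)).Local v)))
  [LocallyCompactSpace (GtLoc L v)] [SecondCountableTopology (GtLoc L v)] [T2Space (GtLoc L v)] [MeasurableSpace (GtLoc L v)] [BorelSpace (GtLoc L v)]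
  [∀ δ : GtLoc L v, MeasurableSpace (GtLoc L v ⧸ epsCentralizer (epsLoc L (splitFormGL L) v) δ)]
  [∀ δ : GtLoc L v, BorelSpace (GtLoc L v ⧸ epsCentralizer (epsLoc L (splitFormGL L) v) δ)]
  [MeasurableSpace ((UnitaryGroup.cmDatum L 3 (splitFormGL L : Matrix (Fin 3) (Fin 3) L)).Local v)] [BorelSpace ((UnitaryGroup.cmDatum L 3 (splitFormGL L : Matrix (Fin 3) (Fin 3) L)).Local v)]
  {δ₀ : GtLoc L v} (hδ₀T : δ₀ ∈ Subgroup.centralizer ({(γ₀.val : GtLoc L v)} : Set (GtLoc L v))) (hδ₀reg : IsEpsRegularAt L (splitFormGL L) v δ₀)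
  (Ψ : (GtLoc L v ⧸ epsCentralizer (epsLoc L (splitFormGL L) v) δ₀) × ↥(Subgroup.centralizer ({(γ₀.val : GtLoc L v)} : Set (GtLoc L v))) → GtLoc L v)
  (hΨ : ∀ (x : GtLoc L v) (b : ↥(Subgroup.centralizer ({(γ₀.val : GtLoc L v)} : Set (GtLoc L v)))), Ψ (QuotientGroup.mk x, b) = x * b * (epsLoc L (splitFormGL L) v x)⁻¹)
  (N' : Subgroup (GtLoc L v))
  (hN' : ∀ m, m ∈ N' ↔ m ∈ Subgroup.normalizer ((Subgroup.centralizer ({(γ₀.val : GtLoc L v)} : Set (GtLoc L v)) : Subgroup (GtLoc L v)) : Set (GtLoc L v)) ∧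
    m * (epsLoc L (splitFormGL L) v m)⁻¹ ∈ Subgroup.centralizer ({(γ₀.val : GtLoc L v)} : Set (GtLoc L v)))
  (s : ↥T → ↥(Subgroup.centralizer ({(γ₀.val : GtLoc L v)} : Set (GtLoc L v)))) (hsm : Measurable s)
  (hsN : ∀ t : ↥T, epsNorm (epsLoc L (splitFormGL L) v) (s t : GtLoc L v) = ((t : (UnitaryGroup.cmDatum L 3 (splitFormGL L : Matrix (Fin 3) (Fin 3) L)).Local v)).val)
  (R : Finset ↥(Subgroup.centralizer ({(γ₀.val : GtLoc L v)} : Set (GtLoc L v))))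
  (hRN : ∀ u ∈ R, epsNorm (epsLoc L (splitFormGL L) v) (u : GtLoc L v) = 1)
  (hRcov : ∀ w : ↥(Subgroup.centralizer ({(γ₀.val : GtLoc L v)} : Set (GtLoc L v))), epsNorm (epsLoc L (splitFormGL L) v) (w : GtLoc L v) = 1 →
    ∃ u ∈ R, ∃ a : ↥(Subgroup.centralizer ({(γ₀.val : GtLoc L v)} : Set (GtLoc L v))), (w : GtLoc L v) = u * (a * (epsLoc L (splitFormGL L) v a)⁻¹))
  (hRinj : ∀ u ∈ R, ∀ u' ∈ R, (∃ a : ↥(Subgroup.centralizer ({(γ₀.val : GtLoc L v)} : Set (GtLoc L v))),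
    ((u' : ↥(Subgroup.centralizer ({(γ₀.val : GtLoc L v)} : Set (GtLoc L v)))) : GtLoc L v) = u * (a * (epsLoc L (splitFormGL L) v a)⁻¹)) → u = u')
  (tT : Measure ↥T) [SigmaFinite tT]
  (τ' : Measure ↥(epsCentralizer (epsLoc L (splitFormGL L) v) δ₀)) [τ'.IsHaarMeasure] [τ'.IsInvInvariant]

/-! ## §1 The weight read through the norm: `Wt := cartanWeight T ∘ N̄` (no weight letter) -/

omit [LocallyCompactSpace (GtLoc L v)] [SecondCountableTopology (GtLoc L v)] [T2Space (GtLoc L v)]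
  [∀ δ : GtLoc L v, MeasurableSpace (GtLoc L v ⧸ epsCentralizer (epsLoc L (splitFormGL L) v) δ)]
  [∀ δ : GtLoc L v, BorelSpace (GtLoc L v ⧸ epsCentralizer (epsLoc L (splitFormGL L) v) δ)] in
include hns hγ₀ hT hsN hRN in
/-- **A BOREL WEIGHT ON `T̃` READING `cartanWeight T` THROUGH THE SHEETS**: `N̄ : T̃ → T`, `N̄ b := N b` (ε-fixed ★ `epsLoc_epsNorm_of_mem_centralizer`, hence in `G_v`
★ `epsLoc_eq_self_iff_mem_local`, and in `Cent(γ₀) = T`) is continuous, so `Wt := cartanWeight T ∘ N̄` is Borel (★ `measurable_cartanWeight`) with `Wt(s t · u) = D_T(t)` (`N(s t u) = t`).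
[cite: Rogawski1990, §12.5 p. 186; §4.9 p. 54] -/
theorem exists_measurable_sheetWeight :
    ∃ Wt : ↥(Subgroup.centralizer ({(γ₀.val : GtLoc L v)} : Set (GtLoc L v))) → ℝ≥0, Measurable Wt ∧ ∀ t : ↥T, ∀ u ∈ R, Wt (s t * u) = cartanWeight L v T t := by
  have hΦ := splitFormGL_isHermitian L
  -- σ-algebra handed to the `Gqs` spelling of the carrier (for ★ `measurable_cartanWeight`)
  letI : MeasurableSpace (Gqs L v) := ‹MeasurableSpace ((UnitaryGroup.cmDatum L 3 (splitFormGL L : Matrix (Fin 3) (Fin 3) L)).Local v)›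
  haveI : BorelSpace (Gqs L v) := ‹BorelSpace ((UnitaryGroup.cmDatum L 3 (splitFormGL L : Matrix (Fin 3) (Fin 3) L)).Local v)›
  have hNU : ∀ b : ↥(Subgroup.centralizer ({(γ₀.val : GtLoc L v)} : Set (GtLoc L v))), epsNorm (epsLoc L (splitFormGL L) v) (b : GtLoc L v) ∈ UnitaryGroup.local L (IsCMField.complexConj L) 3 (splitFormGL L : Matrix (Fin 3) (Fin 3) L) v :=
    fun b => (epsLoc_eq_self_iff_mem_local L (splitFormGL L) v _).1 (epsLoc_epsNorm_of_mem_centralizer hΦ hγ₀ b.2)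
  have hNT : ∀ b : ↥(Subgroup.centralizer ({(γ₀.val : GtLoc L v)} : Set (GtLoc L v))), (⟨epsNorm (epsLoc L (splitFormGL L) v) (b : GtLoc L v), hNU b⟩ : (UnitaryGroup.cmDatum L 3 (splitFormGL L : Matrix (Fin 3) (Fin 3) L)).Local v) ∈ T := fun b => by
    rw [hT]; exact (coe_mem_centralizer_coe_iff γ₀ _).1 (epsNorm_mem_centralizer_coe γ₀ b.2)
  have hNc : Continuous fun b : ↥(Subgroup.centralizer ({(γ₀.val : GtLoc L v)} : Set (GtLoc L v))) => (⟨⟨epsNorm (epsLoc L (splitFormGL L) v) (b : GtLoc L v), hNU b⟩, hNT b⟩ : ↥T) :=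
    ((continuous_subtype_val.mul ((continuous_epsLoc L (splitFormGL L) v).comp continuous_subtype_val)).subtype_mk _).subtype_mk _
  have hNsheet : ∀ t : ↥T, ∀ u ∈ R, (⟨⟨epsNorm (epsLoc L (splitFormGL L) v) ((s t * u : ↥(Subgroup.centralizer ({(γ₀.val : GtLoc L v)} : Set (GtLoc L v)))) : GtLoc L v), hNU (s t * u)⟩, hNT (s t * u)⟩ : ↥T) = t :=
    fun t u hu => Subtype.ext (Subtype.ext (epsNorm_sheet hγ₀ s hsN R hRN t u hu))
  exact ⟨fun b => cartanWeight L v T ⟨⟨epsNorm (epsLoc L (splitFormGL L) v) (b : GtLoc L v), hNU b⟩, hNT b⟩, (measurable_cartanWeight L v hns T).comp hNc.measurable,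
    fun t u hu => by show cartanWeight L v T _ = _; rw [hNsheet t u hu]⟩

/-! ## §2 The T̃-side computation: from the radial integral over `B₀` to print's variable on `T^{reg}` -/

omit [SigmaFinite tT] [BorelSpace ((UnitaryGroup.cmDatum L 3 (splitFormGL L : Matrix (Fin 3) (Fin 3) L)).Local v)] in
/-- **FROM PRODUCT INTEGRABILITY TO THE RADIAL INTEGRAND** (Fubini + density ↔ scalar): if `(b, q) ↦ g(Ψ(q, b))` is integrable for `((λ|_{B₀}) · Wt) ⊗ μ₀` (part 2b's first conclusion,
or its (3′) twin's), then `b ↦ Wt(b) • ∫ g(Ψ(q, b)) dμ₀(q)` is `λ|_{B₀}`-integrable. [cite: Rogawski1990, §12.5 p. 186] [cite: Federer1969, §2.10.10] -/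
theorem integrable_sheetWeight_smul_integral_of_prod (νGt : Measure (GtLoc L v)) [νGt.IsHaarMeasure] [νGt.IsMulRightInvariant]
    (Wt : ↥(Subgroup.centralizer ({(γ₀.val : GtLoc L v)} : Set (GtLoc L v))) → ℝ≥0) (hWtm : Measurable Wt) {E : Type*} [NormedAddCommGroup E] [NormedSpace ℝ E] (g : GtLoc L v → E)
    (hInt : Integrable (fun p : ↥(Subgroup.centralizer ({(γ₀.val : GtLoc L v)} : Set (GtLoc L v))) × (GtLoc L v ⧸ epsCentralizer (epsLoc L (splitFormGL L) v) δ₀) => g (Ψ (p.2, p.1)))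
        (((((∑ u ∈ R, Measure.map (fun t : ↥T => s t * u) (tT.restrict {t : ↥T | IsRegularElt (((t : (UnitaryGroup.cmDatum L 3 (splitFormGL L : Matrix (Fin 3) (Fin 3) L)).Local v)).val : GtLoc L v)}))).restrict {b : ↥(Subgroup.centralizer ({(γ₀.val : GtLoc L v)} : Set (GtLoc L v))) | ∃ t : ↥T, IsRegularElt (((t : (UnitaryGroup.cmDatum L 3 (splitFormGL L : Matrix (Fin 3) (Fin 3) L)).Local v)).val : GtLoc L v) ∧ ∃ u ∈ R, b = s t * u}).withDensity fun b => (Wt b : ℝ≥0∞)).prod (quotientMeasure (epsCentralizer (epsLoc L (splitFormGL L) v) δ₀) τ' (isClosed_epsCentralizer L (splitFormGL L) v δ₀) νGt))) :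
    Integrable (fun b : ↥(Subgroup.centralizer ({(γ₀.val : GtLoc L v)} : Set (GtLoc L v))) => (Wt b : ℝ) • ∫ q, g (Ψ (q, b)) ∂(quotientMeasure (epsCentralizer (epsLoc L (splitFormGL L) v) δ₀) τ' (isClosed_epsCentralizer L (splitFormGL L) v δ₀) νGt)) (((∑ u ∈ R, Measure.map (fun t : ↥T => s t * u) (tT.restrict {t : ↥T | IsRegularElt (((t : (UnitaryGroup.cmDatum L 3 (splitFormGL L : Matrix (Fin 3) (Fin 3) L)).Local v)).val : GtLoc L v)}))).restrict {b : ↥(Subgroup.centralizer ({(γ₀.val : GtLoc L v)} : Set (GtLoc L v))) | ∃ t : ↥T, IsRegularElt (((t : (UnitaryGroup.cmDatum L 3 (splitFormGL L : Matrix (Fin 3) (Fin 3) L)).Local v)).val : GtLoc L v) ∧ ∃ u ∈ R, b = s t * u}) := by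
  haveI : IsClosed ((epsCentralizer (epsLoc L (splitFormGL L) v) δ₀ : Subgroup (GtLoc L v)) : Set (GtLoc L v)) := isClosed_epsCentralizer L (splitFormGL L) v δ₀
  haveI : SecondCountableTopology (GtLoc L v ⧸ epsCentralizer (epsLoc L (splitFormGL L) v) δ₀) := (QuotientGroup.isQuotientMap_mk _).secondCountableTopology QuotientGroup.isOpenMap_coe
  haveI : LocallyCompactSpace (GtLoc L v ⧸ epsCentralizer (epsLoc L (splitFormGL L) v) δ₀) := QuotientGroup.instLocallyCompactSpace _
  haveI : SigmaCompactSpace (GtLoc L v ⧸ epsCentralizer (epsLoc L (splitFormGL L) v) δ₀) := sigmaCompactSpace_of_locallyCompact_secondCountable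
  haveI : SigmaFinite (quotientMeasure (epsCentralizer (epsLoc L (splitFormGL L) v) δ₀) τ' (isClosed_epsCentralizer L (splitFormGL L) v δ₀) νGt) := SigmaFinite.of_isFiniteMeasureOnCompacts _
  have h2 : Integrable (fun b : ↥(Subgroup.centralizer ({(γ₀.val : GtLoc L v)} : Set (GtLoc L v))) => ∫ q, g (Ψ (q, b)) ∂(quotientMeasure (epsCentralizer (epsLoc L (splitFormGL L) v) δ₀) τ' (isClosed_epsCentralizer L (splitFormGL L) v δ₀) νGt)) ((((∑ u ∈ R, Measure.map (fun t : ↥T => s t * u) (tT.restrict {t : ↥T | IsRegularElt (((t : (UnitaryGroup.cmDatum L 3 (splitFormGL L : Matrix (Fin 3) (Fin 3) L)).Local v)).val : GtLoc L v)}))).restrict {b : ↥(Subgroup.centralizer ({(γ₀.val : GtLoc L v)} : Set (GtLoc L v))) | ∃ t : ↥T, IsRegularElt (((t : (UnitaryGroup.cmDatum L 3 (splitFormGL L : Matrix (Fin 3) (Fin 3) L)).Local v)).val : GtLoc L v) ∧ ∃ u ∈ R, b = s t * u}).withDensity fun b => (Wt b : ℝ≥0∞)) :=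
    hInt.integral_prod_left
  have h3 := (integrable_withDensity_iff_integrable_smul hWtm).1 h2
  simpa only [NNReal.smul_def] using h3

set_option maxHeartbeats 800000 in
-- instance-term unification on the CM local carrier (`G̃_v ⧸ T′`, `quotientMeasure`), as in ★ (E1b) `F0P3cStCharTSWeylCartanJacobian`
omit [SigmaFinite tT] in
include hns hγ₀ hT hδ₀T hδ₀reg hΨ hsm hsN hRN hRcov hRinj in
/-- **THE T̃-SIDE OF THE TWISTED WEYL FORMULA OF ONE TUBE, IN PRINT'S VARIABLE** — letter-free in the Jacobian: for ANY weight `Wt` reading `cartanWeight T` through the sheets, `mGt`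
canonical for `νGt`, `τ′(compact core of T′) = 1`, `β` an ε-stable class function, `sec₀` a norm section, and the radial integrand `G(b) := Wt(b) • ∫ φ(Ψ(q,b)) β(Ψ(q,b)) dμ₀(q)`
`λ|_{B₀}`-integrable: `t ↦ D_T(t) • (Φ^{st}_ε(sec₀ t, φ) β(sec₀ t))` is `t_T`-integrable on `T^{reg}` and **`∫_{B₀} G dλ = ∫_{T^{reg}} D_T(t) • (Φ^{st}_ε(sec₀ t, φ) · β(sec₀ t)) dt_T`.**
Inner integral `= Φ_ε(⟦b⟧, φ) β(b)` (ε-stability of `β` ★ `isStablyEpsConjAt_of_isEpsConj`; ★ β CAN-ID + ★ `descEpsConj_base_mk`); `λ` unpacked sheet by sheet (part 1 `integral_sheetMeasure`);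
pointwise sheet sum = stable ε-orbital integral (part 1 `sum_sheet_classEpsOrbitalIntegral_mul_eq`).  Consumed by §3 (letter (3)) and by the (3′) twin of part 2b alike.
[cite: Rogawski1990, §12.5 p. 186; §4.10 (4.10.1) p. 57; §4.3 (4.3.1) p. 43] [cite: HarishChandra1970, Lemma 42] [cite: Federer1969, §2.10.10] -/
theorem integrableOn_and_setIntegral_sheetTransversal_eq_setIntegral_cartanWeight_smul (νGt : Measure (GtLoc L v)) [νGt.IsHaarMeasure] [νGt.IsMulRightInvariant]
    (mGt : EpsOrbitalMeasureFamily (epsLoc L (splitFormGL L) v) ⊥) (hcan : IsEpsCanonicalAt L (splitFormGL L) v νGt mGt)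
    (h1 : τ' (compactCore ↥(epsCentralizer (epsLoc L (splitFormGL L) v) δ₀)) = 1)
    (Wt : ↥(Subgroup.centralizer ({(γ₀.val : GtLoc L v)} : Set (GtLoc L v))) → ℝ≥0) (hWt : ∀ t : ↥T, ∀ u ∈ R, Wt (s t * u) = cartanWeight L v T t)
    (φ β : GtLoc L v → ℂ) (hβ : ∀ δ δ' : GtLoc L v, IsStablyEpsConjAt L (splitFormGL L) v δ δ' → β δ = β δ')
    (sec₀ : (UnitaryGroup.cmDatum L 3 (splitFormGL L : Matrix (Fin 3) (Fin 3) L)).Local v → GtLoc L v) (hsec₀ : ∀ γ, IsEpsNormPair L (splitFormGL L) v (sec₀ γ) γ)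
    (hG : Integrable (fun b : ↥(Subgroup.centralizer ({(γ₀.val : GtLoc L v)} : Set (GtLoc L v))) => (Wt b : ℝ) • ∫ q, φ (Ψ (q, b)) * β (Ψ (q, b)) ∂(quotientMeasure (epsCentralizer (epsLoc L (splitFormGL L) v) δ₀) τ' (isClosed_epsCentralizer L (splitFormGL L) v δ₀) νGt)) (((∑ u ∈ R, Measure.map (fun t : ↥T => s t * u) (tT.restrict {t : ↥T | IsRegularElt (((t : (UnitaryGroup.cmDatum L 3 (splitFormGL L : Matrix (Fin 3) (Fin 3) L)).Local v)).val : GtLoc L v)}))).restrict {b : ↥(Subgroup.centralizer ({(γ₀.val : GtLoc L v)} : Set (GtLoc L v))) | ∃ t : ↥T, IsRegularElt (((t : (UnitaryGroup.cmDatum L 3 (splitFormGL L : Matrix (Fin 3) (Fin 3) L)).Local v)).val : GtLoc L v) ∧ ∃ u ∈ R, b = s t * u})) :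
    IntegrableOn (fun t : ↥T => (cartanWeight L v T t : ℝ) •
        (stableEpsOrbitalIntegral L (splitFormGL L) v mGt φ (sec₀ (t : (UnitaryGroup.cmDatum L 3 (splitFormGL L : Matrix (Fin 3) (Fin 3) L)).Local v)) * β (sec₀ (t : (UnitaryGroup.cmDatum L 3 (splitFormGL L : Matrix (Fin 3) (Fin 3) L)).Local v)))) {t : ↥T | IsRegularElt (((t : (UnitaryGroup.cmDatum L 3 (splitFormGL L : Matrix (Fin 3) (Fin 3) L)).Local v)).val : GtLoc L v)} tT ∧
    ∫ b in {b : ↥(Subgroup.centralizer ({(γ₀.val : GtLoc L v)} : Set (GtLoc L v))) | ∃ t : ↥T, IsRegularElt (((t : (UnitaryGroup.cmDatum L 3 (splitFormGL L : Matrix (Fin 3) (Fin 3) L)).Local v)).val : GtLoc L v) ∧ ∃ u ∈ R, b = s t * u}, (Wt b : ℝ) • ∫ q, φ (Ψ (q, b)) * β (Ψ (q, b)) ∂(quotientMeasure (epsCentralizer (epsLoc L (splitFormGL L) v) δ₀) τ' (isClosed_epsCentralizer L (splitFormGL L) v δ₀) νGt) ∂(∑ u ∈ R, Measure.map (fun t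 : ↥T => s t * u) (tT.restrict {t : ↥T | IsRegularElt (((t : (UnitaryGroup.cmDatum L 3 (splitFormGL L : Matrix (Fin 3) (Fin 3) L)).Local v)).val : GtLoc L v)})) =
      ∫ t in {t : ↥T | IsRegularElt (((t : (UnitaryGroup.cmDatum L 3 (splitFormGL L : Matrix (Fin 3) (Fin 3) L)).Local v)).val : GtLoc L v)}, (cartanWeight L v T t : ℝ) •
        (stableEpsOrbitalIntegral L (splitFormGL L) v mGt φ (sec₀ (t : (UnitaryGroup.cmDatum L 3 (splitFormGL L : Matrix (Fin 3) (Fin 3) L)).Local v)) * β (sec₀ (t : (UnitaryGroup.cmDatum L 3 (splitFormGL L : Matrix (Fin 3) (Fin 3) L)).Local v))) ∂tT := by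
  classical
  have hΦ := splitFormGL_isHermitian L
  -- measurability of `T^{reg}` and `B₀`
  have hregm : MeasurableSet {t : ↥T | IsRegularElt (((t : (UnitaryGroup.cmDatum L 3 (splitFormGL L : Matrix (Fin 3) (Fin 3) L)).Local v)).val : GtLoc L v)} := by
    obtain ⟨w⟩ := (inferInstance : Nonempty (PlacesOver L v))
    exact ((isOpen_setOf_isRegularElt_cmDatum_local (L := L) (H := (splitFormGL L : Matrix (Fin 3) (Fin 3) L)) (v := v) w (hns w)).preimage
      continuous_subtype_val).measurableSet
  have hB₀m : MeasurableSet {b : ↥(Subgroup.centralizer ({(γ₀.val : GtLoc L v)} : Set (GtLoc L v))) | ∃ t : ↥T, IsRegularElt (((t : (UnitaryGroup.cmDatum L 3 (splitFormGL L : Matrix (Fin 3) (Fin 3) L)).Local v)).val : GtLoc L v) ∧ ∃ u ∈ R, b = s t * u} := measurableSet_sheetTransversal hγ₀ hT s hsN R hRN hns hsm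
  -- ε-stability of `β` along the tube and ★ β's CAN-ID: the inner integral at `b ∈ B₀`
  have hinner : ∀ b : ↥(Subgroup.centralizer ({(γ₀.val : GtLoc L v)} : Set (GtLoc L v))), b ∈ {b : ↥(Subgroup.centralizer ({(γ₀.val : GtLoc L v)} : Set (GtLoc L v))) | ∃ t : ↥T, IsRegularElt (((t : (UnitaryGroup.cmDatum L 3 (splitFormGL L : Matrix (Fin 3) (Fin 3) L)).Local v)).val : GtLoc L v) ∧ ∃ u ∈ R, b = s t * u} →
      ∫ q, φ (Ψ (q, b)) * β (Ψ (q, b)) ∂(quotientMeasure (epsCentralizer (epsLoc L (splitFormGL L) v) δ₀) τ' (isClosed_epsCentralizer L (splitFormGL L) v δ₀) νGt) =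
        classEpsOrbitalIntegral (epsLoc L (splitFormGL L) v) mGt φ (Quotient.mk (Relation.EqvGen.setoid (epsConjModRel (epsLoc L (splitFormGL L) v) ⊥)) (b : GtLoc L v)) * β (b : GtLoc L v) := by
    intro b hb
    have hbreg : IsEpsRegularAt L (splitFormGL L) v (b : GtLoc L v) := isEpsRegularAt_of_mem_sheetTransversal hγ₀ s hsN R hRN hb
    have hβq : ∀ q, β (Ψ (q, b)) = β (b : GtLoc L v) := fun q => by
      induction q using QuotientGroup.induction_on with
      | H x => rw [hΨ]; exact (hβ _ _ (isStablyEpsConjAt_of_isEpsConj hΦ (isEpsConj_mul_mul_inv (epsLoc L (splitFormGL L) v) x (b : GtLoc L v)))).symm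
    have hdesc : (descEpsConj (epsLoc L (splitFormGL L) v) (b : GtLoc L v) (epsCentralizer (epsLoc L (splitFormGL L) v) δ₀) φ) = fun q => φ (Ψ (q, b)) := by
      funext q
      induction q using QuotientGroup.induction_on with
      | H x => rw [descEpsConj_base_mk hΦ hγ₀ b.2 hbreg hδ₀T hδ₀reg φ x, hΨ]
    have hcan' := IsEpsCanonicalAt.classEpsOrbitalIntegral_mk_eq_integral_descEpsConj_base hΦ hcan hγ₀ hδ₀T hδ₀reg τ' h1 b.2 hbreg φ
    rw [hdesc] at hcan'
    simp only [hβq]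
    rw [integral_mul_const, hcan']
  -- `∫_{B₀} G dλ = Σ_u ∫_{T^{reg}} G(s t u) dt_T` (part 1 `integral_sheetMeasure` on `B₀.indicator G`)
  have hsheets : ∫ b in {b : ↥(Subgroup.centralizer ({(γ₀.val : GtLoc L v)} : Set (GtLoc L v))) | ∃ t : ↥T, IsRegularElt (((t : (UnitaryGroup.cmDatum L 3 (splitFormGL L : Matrix (Fin 3) (Fin 3) L)).Local v)).val : GtLoc L v) ∧ ∃ u ∈ R, b = s t * u}, (Wt b : ℝ) • ∫ q, φ (Ψ (q, b)) * β (Ψ (q, b)) ∂(quotientMeasure (epsCentralizer (epsLoc L (splitFormGL L) v) δ₀) τ' (isClosed_epsCentralizer L (splitFormGL L) v δ₀) νGt) ∂(∑ u ∈ R, Measure.map (fun t : ↥T => s t * u) (tT.restrict {t : ↥T | IsRegularElt (((t : (UnitaryGroup.cmDatum L 3 (splitFormGL L : Matrix (Fin 3) (Fin 3) L)).Local v)).val : GtLoc L v)})) =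
      ∑ u ∈ R, ∫ t in {t : ↥T | IsRegularElt (((t : (UnitaryGroup.cmDatum L 3 (splitFormGL L : Matrix (Fin 3) (Fin 3) L)).Local v)).val : GtLoc L v)}, (cartanWeight L v T t : ℝ) •
        (classEpsOrbitalIntegral (epsLoc L (splitFormGL L) v) mGt φ (Quotient.mk (Relation.EqvGen.setoid (epsConjModRel (epsLoc L (splitFormGL L) v) ⊥)) ((s t * u : ↥(Subgroup.centralizer ({(γ₀.val : GtLoc L v)} : Set (GtLoc L v)))) : GtLoc L v)) *
          β ((s t * u : ↥(Subgroup.centralizer ({(γ₀.val : GtLoc L v)} : Set (GtLoc L v)))) : GtLoc L v)) ∂tT := by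
    rw [← integral_indicator hB₀m, integral_sheetMeasure s R hsm (tT.restrict {t : ↥T | IsRegularElt (((t : (UnitaryGroup.cmDatum L 3 (splitFormGL L : Matrix (Fin 3) (Fin 3) L)).Local v)).val : GtLoc L v)}) ((integrable_indicator_iff hB₀m).2 hG)]
    refine Finset.sum_congr rfl fun u hu => setIntegral_congr_fun hregm fun t ht => ?_
    have hb : s t * u ∈ {b : ↥(Subgroup.centralizer ({(γ₀.val : GtLoc L v)} : Set (GtLoc L v))) | ∃ t : ↥T, IsRegularElt (((t : (UnitaryGroup.cmDatum L 3 (splitFormGL L : Matrix (Fin 3) (Fin 3) L)).Local v)).val : GtLoc L v) ∧ ∃ u ∈ R, b = s t * u} := ⟨t, ht, u, hu, rfl⟩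
    rw [indicator_of_mem hb, hWt t u hu, hinner _ hb]
  -- each sheet summand is integrable on `T^{reg}`
  have hle : ∀ u ∈ R, Measure.map (fun t : ↥T => s t * u) (tT.restrict {t : ↥T | IsRegularElt (((t : (UnitaryGroup.cmDatum L 3 (splitFormGL L : Matrix (Fin 3) (Fin 3) L)).Local v)).val : GtLoc L v)}) ≤ (∑ u ∈ R, Measure.map (fun t : ↥T => s t * u) (tT.restrict {t : ↥T | IsRegularElt (((t : (UnitaryGroup.cmDatum L 3 (splitFormGL L : Matrix (Fin 3) (Fin 3) L)).Local v)).val : GtLoc L v)})) := fun u hu =>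
    calc Measure.map (fun t : ↥T => s t * u) (tT.restrict {t : ↥T | IsRegularElt (((t : (UnitaryGroup.cmDatum L 3 (splitFormGL L : Matrix (Fin 3) (Fin 3) L)).Local v)).val : GtLoc L v)})
        ≤ Measure.map (fun t : ↥T => s t * u) (tT.restrict {t : ↥T | IsRegularElt (((t : (UnitaryGroup.cmDatum L 3 (splitFormGL L : Matrix (Fin 3) (Fin 3) L)).Local v)).val : GtLoc L v)}) + ∑ u' ∈ R.erase u, Measure.map (fun t : ↥T => s t * u') (tT.restrict {t : ↥T | IsRegularElt (((t : (UnitaryGroup.cmDatum L 3 (splitFormGL L : Matrix (Fin 3) (Fin 3) L)).Local v)).val : GtLoc L v)}) :=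
          Measure.le_add_right le_rfl
      _ = (∑ u ∈ R, Measure.map (fun t : ↥T => s t * u) (tT.restrict {t : ↥T | IsRegularElt (((t : (UnitaryGroup.cmDatum L 3 (splitFormGL L : Matrix (Fin 3) (Fin 3) L)).Local v)).val : GtLoc L v)})) := Finset.add_sum_erase R (fun u' => Measure.map (fun t : ↥T => s t * u') (tT.restrict {t : ↥T | IsRegularElt (((t : (UnitaryGroup.cmDatum L 3 (splitFormGL L : Matrix (Fin 3) (Fin 3) L)).Local v)).val : GtLoc L v)})) hu
  have hGu : ∀ u ∈ R, IntegrableOn (fun t : ↥T => (cartanWeight L v T t : ℝ) •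
      (classEpsOrbitalIntegral (epsLoc L (splitFormGL L) v) mGt φ (Quotient.mk (Relation.EqvGen.setoid (epsConjModRel (epsLoc L (splitFormGL L) v) ⊥)) ((s t * u : ↥(Subgroup.centralizer ({(γ₀.val : GtLoc L v)} : Set (GtLoc L v)))) : GtLoc L v)) *
        β ((s t * u : ↥(Subgroup.centralizer ({(γ₀.val : GtLoc L v)} : Set (GtLoc L v)))) : GtLoc L v))) {t : ↥T | IsRegularElt (((t : (UnitaryGroup.cmDatum L 3 (splitFormGL L : Matrix (Fin 3) (Fin 3) L)).Local v)).val : GtLoc L v)} tT := by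
    intro u hu
    have h4 : Integrable ((Set.indicator {b : ↥(Subgroup.centralizer ({(γ₀.val : GtLoc L v)} : Set (GtLoc L v))) | ∃ t : ↥T, IsRegularElt (((t : (UnitaryGroup.cmDatum L 3 (splitFormGL L : Matrix (Fin 3) (Fin 3) L)).Local v)).val : GtLoc L v) ∧ ∃ u ∈ R, b = s t * u} fun b : ↥(Subgroup.centralizer ({(γ₀.val : GtLoc L v)} : Set (GtLoc L v))) => (Wt b : ℝ) • ∫ q, φ (Ψ (q, b)) * β (Ψ (q, b)) ∂(quotientMeasure (epsCentralizer (epsLoc L (splitFormGL L) v) δ₀) τ' (isClosed_epsCentralizer L (splitFormGL L) v δ₀) νGt)) ∘ fun t : ↥T => s t * u)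
        (tT.restrict {t : ↥T | IsRegularElt (((t : (UnitaryGroup.cmDatum L 3 (splitFormGL L : Matrix (Fin 3) (Fin 3) L)).Local v)).val : GtLoc L v)}) :=
      (((integrable_indicator_iff hB₀m).2 hG).mono_measure (hle u hu)).comp_measurable (hsm.mul_const u)
    refine h4.congr ((ae_restrict_mem hregm).mono fun t ht => ?_)
    have hb : s t * u ∈ {b : ↥(Subgroup.centralizer ({(γ₀.val : GtLoc L v)} : Set (GtLoc L v))) | ∃ t : ↥T, IsRegularElt (((t : (UnitaryGroup.cmDatum L 3 (splitFormGL L : Matrix (Fin 3) (Fin 3) L)).Local v)).val : GtLoc L v) ∧ ∃ u ∈ R, b = s t * u} := ⟨t, ht, u, hu, rfl⟩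
    show Set.indicator {b : ↥(Subgroup.centralizer ({(γ₀.val : GtLoc L v)} : Set (GtLoc L v))) | ∃ t : ↥T, IsRegularElt (((t : (UnitaryGroup.cmDatum L 3 (splitFormGL L : Matrix (Fin 3) (Fin 3) L)).Local v)).val : GtLoc L v) ∧ ∃ u ∈ R, b = s t * u} (fun b : ↥(Subgroup.centralizer ({(γ₀.val : GtLoc L v)} : Set (GtLoc L v))) => (Wt b : ℝ) • ∫ q, φ (Ψ (q, b)) * β (Ψ (q, b)) ∂(quotientMeasure (epsCentralizer (epsLoc L (splitFormGL L) v) δ₀) τ' (isClosed_epsCentralizer L (splitFormGL L) v δ₀) νGt)) (s t * u) = _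
    rw [indicator_of_mem hb, hWt t u hu, hinner _ hb]
  -- swap the finite sum and the integral, then the pointwise sheet sum (part 1 ∕ ★ M4-b) on `T^{reg}`
  have hswap : ∑ u ∈ R, ∫ t in {t : ↥T | IsRegularElt (((t : (UnitaryGroup.cmDatum L 3 (splitFormGL L : Matrix (Fin 3) (Fin 3) L)).Local v)).val : GtLoc L v)}, (cartanWeight L v T t : ℝ) •
        (classEpsOrbitalIntegral (epsLoc L (splitFormGL L) v) mGt φ (Quotient.mk (Relation.EqvGen.setoid (epsConjModRel (epsLoc L (splitFormGL L) v) ⊥)) ((s t * u : ↥(Subgroup.centralizer ({(γ₀.val : GtLoc L v)} : Set (GtLoc L v)))) : GtLoc L v)) *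
          β ((s t * u : ↥(Subgroup.centralizer ({(γ₀.val : GtLoc L v)} : Set (GtLoc L v)))) : GtLoc L v)) ∂tT =
      ∫ t in {t : ↥T | IsRegularElt (((t : (UnitaryGroup.cmDatum L 3 (splitFormGL L : Matrix (Fin 3) (Fin 3) L)).Local v)).val : GtLoc L v)}, ∑ u ∈ R, (cartanWeight L v T t : ℝ) •
        (classEpsOrbitalIntegral (epsLoc L (splitFormGL L) v) mGt φ (Quotient.mk (Relation.EqvGen.setoid (epsConjModRel (epsLoc L (splitFormGL L) v) ⊥)) ((s t * u : ↥(Subgroup.centralizer ({(γ₀.val : GtLoc L v)} : Set (GtLoc L v)))) : GtLoc L v)) *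
          β ((s t * u : ↥(Subgroup.centralizer ({(γ₀.val : GtLoc L v)} : Set (GtLoc L v)))) : GtLoc L v)) ∂tT :=
    (integral_finsetSum R fun u hu => hGu u hu).symm
  have hpt : ∀ t ∈ {t : ↥T | IsRegularElt (((t : (UnitaryGroup.cmDatum L 3 (splitFormGL L : Matrix (Fin 3) (Fin 3) L)).Local v)).val : GtLoc L v)}, ∑ u ∈ R, (cartanWeight L v T t : ℝ) •
        (classEpsOrbitalIntegral (epsLoc L (splitFormGL L) v) mGt φ (Quotient.mk (Relation.EqvGen.setoid (epsConjModRel (epsLoc L (splitFormGL L) v) ⊥)) ((s t * u : ↥(Subgroup.centralizer ({(γ₀.val : GtLoc L v)} : Set (GtLoc L v)))) : GtLoc L v)) *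
          β ((s t * u : ↥(Subgroup.centralizer ({(γ₀.val : GtLoc L v)} : Set (GtLoc L v)))) : GtLoc L v)) =
      (cartanWeight L v T t : ℝ) • (stableEpsOrbitalIntegral L (splitFormGL L) v mGt φ (sec₀ (t : (UnitaryGroup.cmDatum L 3 (splitFormGL L : Matrix (Fin 3) (Fin 3) L)).Local v)) * β (sec₀ (t : (UnitaryGroup.cmDatum L 3 (splitFormGL L : Matrix (Fin 3) (Fin 3) L)).Local v))) := by
    intro t ht
    rw [← Finset.smul_sum, sum_sheet_classEpsOrbitalIntegral_mul_eq hγ₀ hT s hsN R hRN hRcov hRinj mGt φ β hβ t ht (hsec₀ (t : (UnitaryGroup.cmDatum L 3 (splitFormGL L : Matrix (Fin 3) (Fin 3) L)).Local v))]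
  refine ⟨?_, ?_⟩
  · exact (integrable_finsetSum R fun u hu => hGu u hu).congr ((ae_restrict_mem hregm).mono fun t ht => hpt t ht)
  · rw [← setIntegral_congr_fun hregm hpt, ← hswap, ← hsheets]

/-! ## §3 The formula of one tube under the letter (J̃♭) (bytes of record) -/

set_option maxHeartbeats 800000 in
-- instance-term unification on the CM local carrier, as in ★ (E1b)
include hns hγ₀ hT hδ₀T hδ₀reg hΨ hN' hsm hsN hRN hRcov hRinj in
/-- **THE TWISTED WEYL INTEGRATION FORMULA OF ONE TUBE** (Rogawski p. 186 for a single Cartan `T`): under (J̃♭) (hypothesis `hJac`, bytes of record 02:06:56Z (3)), with `mGt`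
canonical for `νGt` and `τ′(compact core of T′) = 1`, for `φ·β` `νGt`-integrable on the tube `Ψ(D)`, `β` an ε-stable class function and `sec₀` a norm section:
`t ↦ D_T(t) • (Φ^{st}_ε(sec₀ t, φ) β(sec₀ t))` is `t_T`-integrable on `T^{reg}` and **`[Ñ^ε_T : T̃] · ∫_{Ψ(D)} φ β dνGt = ∫_{T^{reg}} D_T(t) • (Φ^{st}_ε(sec₀ t, φ) · β(sec₀ t)) dt_T`**
(§1 weight, part 2b's Bochner radial identity at `g = φ β`, §2). [cite: Rogawski1990, §12.5 p. 186; §4.10 (4.10.1) p. 57] [cite: HarishChandra1970, Lemma 42] [cite: Federer1969, §2.10.10] -/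
theorem integrableOn_and_index_mul_setIntegral_epsTube_eq (νGt : Measure (GtLoc L v)) [νGt.IsHaarMeasure] [νGt.IsMulRightInvariant]
    (mGt : EpsOrbitalMeasureFamily (epsLoc L (splitFormGL L) v) ⊥) (hcan : IsEpsCanonicalAt L (splitFormGL L) v νGt mGt)
    (h1 : τ' (compactCore ↥(epsCentralizer (epsLoc L (splitFormGL L) v) δ₀)) = 1)
    (hJac : ∀ t₁ : ↥T, IsRegularElt (((t₁ : (UnitaryGroup.cmDatum L 3 (splitFormGL L : Matrix (Fin 3) (Fin 3) L)).Local v)).val : GtLoc L v) →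
      ∃ U : Set ↥T, IsOpen U ∧ t₁ ∈ U ∧
      ∃ A₀ : Set (GtLoc L v ⧸ epsCentralizer (epsLoc L (splitFormGL L) v) δ₀), MeasurableSet A₀ ∧ (quotientMeasure (epsCentralizer (epsLoc L (splitFormGL L) v) δ₀) τ' (isClosed_epsCentralizer L (splitFormGL L) v δ₀) νGt) A₀ ≠ 0 ∧ (quotientMeasure (epsCentralizer (epsLoc L (splitFormGL L) v) δ₀) τ' (isClosed_epsCentralizer L (splitFormGL L) v δ₀) νGt) A₀ ≠ ⊤ ∧
        ∀ u ∈ R, ∀ V : Set ↥T, MeasurableSet V → V ⊆ U ∩ {t : ↥T | IsRegularElt (((t : (UnitaryGroup.cmDatum L 3 (splitFormGL L : Matrix (Fin 3) (Fin 3) L)).Local v)).val : GtLoc L v)} →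
          νGt (Ψ '' (A₀ ×ˢ ((fun t : ↥T => s t * u) '' V))) = (quotientMeasure (epsCentralizer (epsLoc L (splitFormGL L) v) δ₀) τ' (isClosed_epsCentralizer L (splitFormGL L) v δ₀) νGt) A₀ * ∫⁻ t in V, (cartanWeight L v T t : ℝ≥0∞) ∂tT)
    (φ β : GtLoc L v → ℂ) (hφβ : IntegrableOn (fun y => φ y * β y) (Ψ '' {p | p.2 ∈ {b : ↥(Subgroup.centralizer ({(γ₀.val : GtLoc L v)} : Set (GtLoc L v))) | ∃ t : ↥T, IsRegularElt (((t : (UnitaryGroup.cmDatum L 3 (splitFormGL L : Matrix (Fin 3) (Fin 3) L)).Local v)).val : GtLoc L v) ∧ ∃ u ∈ R, b = s t * u}}) νGt)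
    (hβ : ∀ δ δ' : GtLoc L v, IsStablyEpsConjAt L (splitFormGL L) v δ δ' → β δ = β δ')
    (sec₀ : (UnitaryGroup.cmDatum L 3 (splitFormGL L : Matrix (Fin 3) (Fin 3) L)).Local v → GtLoc L v) (hsec₀ : ∀ γ, IsEpsNormPair L (splitFormGL L) v (sec₀ γ) γ) :
    IntegrableOn (fun t : ↥T => (cartanWeight L v T t : ℝ) •
        (stableEpsOrbitalIntegral L (splitFormGL L) v mGt φ (sec₀ (t : (UnitaryGroup.cmDatum L 3 (splitFormGL L : Matrix (Fin 3) (Fin 3) L)).Local v)) * β (sec₀ (t : (UnitaryGroup.cmDatum L 3 (splitFormGL L : Matrix (Fin 3) (Fin 3) L)).Local v)))) {t : ↥T | IsRegularElt (((t : (UnitaryGroup.cmDatum L 3 (splitFormGL L : Matrix (Fin 3) (Fin 3) L)).Local v)).val : GtLoc L v)} tT ∧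
    (((((Subgroup.centralizer ({(γ₀.val : GtLoc L v)} : Set (GtLoc L v))).subgroupOf N').index : ℕ) : ℂ) * ∫ y in Ψ '' {p | p.2 ∈ {b : ↥(Subgroup.centralizer ({(γ₀.val : GtLoc L v)} : Set (GtLoc L v))) | ∃ t : ↥T, IsRegularElt (((t : (UnitaryGroup.cmDatum L 3 (splitFormGL L : Matrix (Fin 3) (Fin 3) L)).Local v)).val : GtLoc L v) ∧ ∃ u ∈ R, b = s t * u}}, φ y * β y ∂νGt =
      ∫ t in {t : ↥T | IsRegularElt (((t : (UnitaryGroup.cmDatum L 3 (splitFormGL L : Matrix (Fin 3) (Fin 3) L)).Local v)).val : GtLoc L v)}, (cartanWeight L v T t : ℝ) •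
        (stableEpsOrbitalIntegral L (splitFormGL L) v mGt φ (sec₀ (t : (UnitaryGroup.cmDatum L 3 (splitFormGL L : Matrix (Fin 3) (Fin 3) L)).Local v)) * β (sec₀ (t : (UnitaryGroup.cmDatum L 3 (splitFormGL L : Matrix (Fin 3) (Fin 3) L)).Local v))) ∂tT) := by
  obtain ⟨Wt, hWtm, hWt⟩ := exists_measurable_sheetWeight hns hγ₀ hT s hsN R hRN
  obtain ⟨hInt, hEq⟩ := integrable_and_integral_epsTube_eq_of_sheetJacobian hns hγ₀ hT hδ₀T hδ₀reg Ψ hΨ N' hN' s hsm hsN R hRN hRcov hRinj tT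
    Wt hWtm hWt τ' νGt hJac (fun y => φ y * β y) hφβ
  have hG := integrable_sheetWeight_smul_integral_of_prod Ψ s R tT τ' νGt Wt hWtm (fun y => φ y * β y) hInt
  obtain ⟨hint, hrad⟩ := integrableOn_and_setIntegral_sheetTransversal_eq_setIntegral_cartanWeight_smul hns hγ₀ hT hδ₀T hδ₀reg Ψ hΨ s hsm hsN R hRN hRcov hRinj
    tT τ' νGt mGt hcan h1 Wt hWt φ β hβ sec₀ hsec₀ hG
  refine ⟨hint, ?_⟩
  rw [← hrad, hEq, Complex.real_smul, Complex.ofReal_natCast]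

end Formula

end Summit.HodgeConjecture.HodgeConjecture.R90.S4

end
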